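import Literature.AlgebraicGeometry.ShimuraVarieties.RapoportSmithlingZhang2020.AppBLocalModelsBanalSignature
import Mathlib.LinearAlgebra.Eigenspace.Minpoly
import Mathlib.LinearAlgebra.Dimension.Free
import Mathlib.RingTheory.OrzechProperty
import Mathlib.Algebra.Polynomial.BigOperators
import HarnessLib

/-!
# [RapoportSmithlingZhang2020Diagonal, App. B Lemma B.1 (arXiv v6 pp. 59–60)] «`M(S)` consists of a single point» — the
# unramified banal reading — DISCHARGED: `RSZ2020_B_1_unramified_holds`

Kernel-lane companion of the statement carpet ★
`Literature/AlgebraicGeometry/ShimuraVarieties/RapoportSmithlingZhang2020/AppBLocalModelsBanalSignature.lean`: its named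
fact ★ `RSZ2020_B_1_unramified` — M. Rapoport, B. Smithling, W. Zhang, *Arithmetic diagonal cycles on unitary Shimura
varieties*, Compositio Math. 156 (2020), Appendix B, Lemma B.1 (arXiv 1710.06962v6 pp. 59–60): «Let `S` be an
`O_{E_r L̃^t}`-scheme. Then `M(S)` consists of a single point», proof: «the Eisenstein condition forces (B.6)
`(P_Λ)_ψ = (Λ ⊗_{O_K} O_S)_ψ / Q_{A_ψ}(π ⊗ 1)·(Λ ⊗_{O_K} O_S)_ψ`», in the carpet's unramified banal reading (`κ = ι`, single
lattice `Λ = O_L^n`, `O_L` free of rank `|Hom_K(L, K̄)|`, affine `S = Spec R ≠ ∅`, the (B.3) idempotents, embeddings separated by a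
unit): every point satisfying the Kottwitz condition (B.2) has kernel exactly (B.6) — is PROVED here.  THEOREMS ONLY (no
definition, no named fact, no `sorry`, no instance, no notation); cell hodgecm-mathlib, seat B-typ04 (g31); net debt −1.

## The proof

With `A = {ψ ∣ r_ψ = n}` (and `r_ψ = 0` otherwise, `r` banal, `n > 0`) the generators of (B.6) are `Q_{A_ψ}(π ⊗ 1) e_ψ = 0` for
`ψ ∈ A` (`A_ψ = {ψ}`, `(π ⊗ 1) e_ψ = ψ(π) e_ψ`) and `= e_ψ` for `ψ ∉ A` (`A_ψ = ∅`), so (B.6) is the submodule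
`E = {v ∣ e_ψ v = 0 for ψ ∈ A} = ⊕_{ψ ∉ A} e_ψ (Λ ⊗ O_S)` (`eisensteinKernel_eq`).
* `E ⊆ ker`: for `ψ ∉ A` the component `(P_Λ)_ψ` vanishes (Lemma B.3's argument: Cayley–Hamilton for the Kottwitz polynomial
  at the separating element gives a unit `∏_φ (ψ(a) − φ(a))^{r_φ}` killing `e_ψ P_Λ`; `component_eq_zero`).
* `ker ⊆ E` — the count «`M ≅ Spec O_{E_r}`»: `P_Λ` is free of rank `deg char = Σ_φ r_φ = n·|A|` (B.2), and
  `(c_{iψ}) ↦ q(Σ_{ψ ∈ A} c_{iψ} e_ψ)`, `O_S^{n·|A|} → P_Λ`, is onto (every `e_ψ x`, `x ∈ O_S ⊗ O_L`, is an `O_S`-multiple of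
  `e_ψ` by (B.3), and the `ψ ∉ A` part dies); a surjection between finite free modules of the same rank is injective
  (Orzech/Vasconcelos, Mathlib `OrzechProperty.injective_of_surjective_endomorphism`), so a kernel vector has no `A`-part.

## References
* [RapoportSmithlingZhang2020Diagonal] M. Rapoport, B. Smithling, W. Zhang, *Arithmetic diagonal cycles on unitary Shimura
  varieties*, Compos. Math. 156 (2020) 1745–1824; arXiv:1710.06962v6, App. B Lemma B.1 and (B.2)–(B.6) (pp. 59–60).
-/

set_option autoImplicit false

noncomputable section

open scoped TensorProduct
open Polynomial

namespace Literature.AlgebraicGeometry.ShimuraVarieties.RapoportSmithlingZhang2020.AppBLocalModelsBanalSignature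

universe u

section Unramified

variable {OK OL R : Type u} [CommRing OK] [CommRing OL] [Algebra OK OL] [CommRing R] [Algebra OK R]
variable {ι : Type u} [Fintype ι] {θ : ι → (OL →+* R)} {e : ι → R ⊗[OK] OL}

/-- (B.3): every element of `e_ψ · (O_S ⊗ O_L)` is an `O_S`-multiple of `e_ψ` (`(1 ⊗ b) e_ψ = ψ(b) e_ψ`). [folklore] -/
private theorem exists_mul_eq_smul (he : IsDecompositionB3 θ e) (ψ : ι) (x : R ⊗[OK] OL) :
    ∃ c : R, e ψ * x = c • e ψ := by
  induction x using TensorProduct.induction_on with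
  | zero => exact ⟨0, by simp⟩
  | tmul r b =>
    refine ⟨r * θ ψ b, ?_⟩
    have h1 : (r ⊗ₜ[OK] b : R ⊗[OK] OL) = r • ((1 : R) ⊗ₜ[OK] b) := by
      rw [TensorProduct.smul_tmul', smul_eq_mul, mul_one]
    rw [h1, mul_smul_comm, mul_comm, he.2.2.2 ψ b, Algebra.algebraMap_eq_smul_one, smul_mul_assoc, one_mul,
      smul_smul]
  | add x y hx hy =>
    obtain ⟨c, hc⟩ := hx
    obtain ⟨d, hd⟩ := hy
    exact ⟨c + d, by rw [mul_add, hc, hd, add_smul]⟩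

variable {P : Type u} [AddCommGroup P] [Module (R ⊗[OK] OL) P] [Module R P] [IsScalarTower R (R ⊗[OK] OL) P]

/-- On `e_ψ · P_Λ` the endomorphism `a ⊗ 1` is the scalar `ψ(a)`. [cite: RapoportSmithlingZhang2020Diagonal, App. B (B.3)–(B.4) p. 59] -/
private theorem act_smul_eq (he : IsDecompositionB3 θ e) (ψ : ι) (a : OL) (p : P) :
    act P ((1 : R) ⊗ₜ[OK] a) (e ψ • p) = θ ψ a • (e ψ • p) := by
  show ((1 : R) ⊗ₜ[OK] a) • (e ψ • p) = θ ψ a • (e ψ • p)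
  rw [← mul_smul, he.2.2.2 ψ a, mul_smul, algebraMap_smul]

/-- **«If `A_ψ` is empty, then `(P_Λ)_ψ = 0`»** (Lemma B.3, p. 60): for `r_ψ = 0`, Cayley–Hamilton for the Kottwitz polynomial
(B.2) at the separating element `a` gives the unit `∏_φ (ψ(a) − φ(a))^{r_φ}` annihilating `e_ψ P_Λ`.
[cite: RapoportSmithlingZhang2020Diagonal, App. B Lemma B.3 p. 60] -/
private theorem component_eq_zero [Module.Free R P] [Module.Finite R P] {r : ι → ℕ} (he : IsDecompositionB3 θ e)
    (hsep : ∃ a : OL, ∀ ψ ψ', ψ ≠ ψ' → IsUnit (θ ψ a - θ ψ' a)) (hK : KottwitzCondition (OK := OK) P r θ)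
    {ψ : ι} (h0 : r ψ = 0) (p : P) : e ψ • p = 0 := by
  classical
  obtain ⟨a, ha⟩ := hsep
  set x := e ψ • p with hx
  have hxa : act P ((1 : R) ⊗ₜ[OK] a) x = θ ψ a • x := act_smul_eq he ψ a p
  have hCH := LinearMap.aeval_self_charpoly (act P ((1 : R) ⊗ₜ[OK] a))
  rw [hK a] at hCH
  have hzero : (∏ φ, (X - C (θ φ a)) ^ r φ).eval (θ ψ a) • x = 0 := by
    rw [← Module.End.aeval_apply_of_mem_apply_eq_smul hxa, hCH, LinearMap.zero_apply]
  simp only [eval_prod, eval_pow, eval_sub, eval_X, eval_C] at hzero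
  have hunit : IsUnit (∏ φ, (θ ψ a - θ φ a) ^ r φ) := by
    refine Finset.prod_induction _ IsUnit (fun _ _ hu hv => hu.mul hv) isUnit_one fun φ _ => ?_
    by_cases hφ : φ = ψ
    · subst hφ
      rw [h0, pow_zero]
      exact isUnit_one
    · exact (ha ψ φ (Ne.symm hφ)).pow _
  exact (hunit.smul_eq_zero).mp hzero

end Unramified

/-- ★ `RSZ2020_B_1_unramified` HOLDS. [RapoportSmithlingZhang2020Diagonal, App. B Lemma B.1 (arXiv v6 pp. 59–60)]: «`M(S)`
consists of a single point» — in the carpet's unramified banal reading: every point `(P_Λ, q)` of the local model over an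
affine `S = Spec R` satisfying the Kottwitz condition (B.2) has `ker q` equal to the submodule (B.6).  Proof: (B.6) is
`{v ∣ e_ψ v = 0 for r_ψ = n}`; it lies in the kernel because the components `(P_Λ)_ψ`, `r_ψ = 0`, vanish (Lemma B.3), and it is
the whole kernel because `O_S^{n|A|} ↠ P_Λ`, `c ↦ q(Σ c e_ψ)`, is a surjection of free `O_S`-modules of the same rank
`Σ r_φ` (B.2), hence injective. [cite: RapoportSmithlingZhang2020Diagonal, App. B Lemma B.1 pp. 59–60] -/
theorem RSZ2020_B_1_unramified_holds : RSZ2020_B_1_unramified.{u} := by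
  intro OK OL R _ _ _ _ _ _ _ ι _ n r θ π e P _ _ _ _ _ _ q hq hn hrank hban he hsep hK
  classical
  -- banality: `r ψ ∈ {0, n}`
  have hZ : ∀ ψ, r ψ ≠ n → r ψ = 0 := fun ψ hψ => (hban ψ).resolve_right hψ
  -- the components with `r ψ = 0` vanish
  have vanish : ∀ ψ, r ψ ≠ n → ∀ p : P, e ψ • p = 0 := fun ψ hψ p =>
    component_eq_zero he hsep hK (hZ ψ hψ) p
  -- the submodule `E' = {v | e_ψ v = 0 for r_ψ = n}`
  let E' : Submodule (R ⊗[OK] OL) (Fin n → R ⊗[OK] OL) :=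
    { carrier := {v | ∀ ψ, r ψ = n → e ψ • v = 0}
      add_mem' := fun {v w} hv hw ψ hψ => by rw [smul_add, hv ψ hψ, hw ψ hψ, add_zero]
      zero_mem' := fun ψ _ => smul_zero _
      smul_mem' := fun m {v} hv ψ hψ => by
        show e ψ • (m • v) = 0
        rw [smul_comm, hv ψ hψ, smul_zero] }
  have memE' : ∀ v : Fin n → R ⊗[OK] OL, v ∈ E' ↔ ∀ ψ, r ψ = n → e ψ • v = 0 := fun v => Iff.rfl
  -- every vector is the sum of its components
  have decomp : ∀ v : Fin n → R ⊗[OK] OL, v = ∑ ψ, e ψ • v := fun v => by rw [← Finset.sum_smul, he.1, one_smul]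
  -- the generators of (B.6)
  have hgen : ∀ ψ, Polynomial.aeval (1 ⊗ₜ[OK] π : R ⊗[OK] OL) (QPoly (fun φ => θ φ π) (ASet n r id ψ)) * e ψ
      = if r ψ = n then 0 else e ψ := by
    intro ψ
    by_cases hψ : r ψ = n
    · have hA : ASet n r id ψ = {ψ} := by
        ext φ
        simp only [ASet, Set.mem_setOf_eq, id, Set.mem_singleton_iff]
        exact ⟨fun h => h.1, fun h => ⟨h, h ▸ hψ⟩⟩
      rw [if_pos hψ, hA, QPoly, finprod_mem_singleton, map_sub, aeval_X, aeval_C, sub_mul, he.2.2.2 ψ π, sub_self]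
    · have hA : ASet n r id ψ = ∅ := by
        ext φ
        simp only [ASet, Set.mem_setOf_eq, id, Set.mem_empty_iff_false, iff_false, not_and]
        rintro rfl
        exact hψ
      rw [if_neg hψ, hA, QPoly, finprod_mem_empty, map_one, one_mul]
  -- (B.6) = E'
  have hEis : eisensteinKernel n r id θ π e = E' := by
    apply le_antisymm
    · refine Submodule.smul_le.mpr fun m hm v _ => (memE' _).mpr fun ψ hψ => ?_
      rw [← mul_smul]
      suffices h : e ψ * m = 0 by rw [h, zero_smul]
      refine Submodule.span_induction (p := fun m _ => e ψ * m = 0) ?_ (mul_zero _) (fun x y _ _ hx hy => by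
        rw [mul_add, hx, hy, add_zero]) (fun a x _ hx => by rw [smul_eq_mul, mul_left_comm, hx, mul_zero]) hm
      rintro _ ⟨ψ', rfl⟩
      dsimp only
      rw [hgen ψ']
      by_cases hψ' : r ψ' = n
      · rw [if_pos hψ', mul_zero]
      · rw [if_neg hψ']
        have hne : ψ ≠ ψ' := fun h => hψ' (h ▸ hψ)
        exact he.2.2.1 ψ ψ' hne
    · intro v hv
      rw [decomp v]
      refine Submodule.sum_mem _ fun ψ _ => ?_
      by_cases hψ : r ψ = n
      · rw [(memE' v).mp hv ψ hψ]
        exact Submodule.zero_mem _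
      · have hg : e ψ ∈ Ideal.span (Set.range fun ψ : ι =>
            Polynomial.aeval (1 ⊗ₜ[OK] π : R ⊗[OK] OL) (QPoly (fun φ => θ φ π) (ASet n r id ψ)) * e ψ) := by
          refine Ideal.subset_span ⟨ψ, ?_⟩
          simp only [hgen ψ, if_neg hψ]
        exact Submodule.smul_mem_smul hg Submodule.mem_top
  rw [hEis]
  -- `E' ⊆ ker q`
  have hE'ker : ∀ v ∈ E', q v = 0 := by
    intro v hv
    rw [decomp v, map_sum]
    refine Finset.sum_eq_zero fun ψ _ => ?_
    by_cases hψ : r ψ = n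
    · rw [(memE' v).mp hv ψ hψ, map_zero]
    · rw [map_smul, vanish ψ hψ]
  apply le_antisymm _ fun v hv => LinearMap.mem_ker.mpr (hE'ker v hv)
  -- `ker q ⊆ E'`: the rank count
  intro v hv
  rw [LinearMap.mem_ker] at hv
  -- the `A`-part map `Φ : (Fin n → A → R) → V`, `c ↦ (i ↦ Σ_{ψ ∈ A} c i ψ • e ψ)`
  let A := {ψ : ι // r ψ = n}
  let Φ : (Fin n → A → R) →ₗ[R] (Fin n → R ⊗[OK] OL) :=
    { toFun := fun c i => ∑ ψ : A, c i ψ • e ψ.1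
      map_add' := fun c d => by
        funext i
        show (∑ ψ : A, (c + d) i ψ • e ψ.1) = (∑ ψ : A, c i ψ • e ψ.1) + ∑ ψ : A, d i ψ • e ψ.1
        simp only [Pi.add_apply, add_smul, Finset.sum_add_distrib]
      map_smul' := fun s c => by
        funext i
        show (∑ ψ : A, (s • c) i ψ • e ψ.1) = s • ∑ ψ : A, c i ψ • e ψ.1
        simp only [Pi.smul_apply, smul_eq_mul, Finset.smul_sum, smul_smul] }
  have hΦ : ∀ (c : Fin n → A → R) (i : Fin n), Φ c i = ∑ ψ : A, c i ψ • e ψ.1 := fun c i => rfl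
  let Ψ : (Fin n → A → R) →ₗ[R] P := (q.restrictScalars R) ∘ₗ Φ
  have hΨ : ∀ c, Ψ c = q (Φ c) := fun c => rfl
  -- every vector splits as `Φ c + (an element of E')`
  have split : ∀ w : Fin n → R ⊗[OK] OL, ∃ c : Fin n → A → R, ∃ z ∈ E', w = Φ c + z := by
    intro w
    choose c hc using fun i (ψ : A) => exists_mul_eq_smul he ψ.1 (w i)
    refine ⟨c, ∑ ψ : {ψ : ι // ¬ r ψ = n}, e ψ.1 • w, ?_, ?_⟩
    · refine Submodule.sum_mem _ fun ψ _ => (memE' _).mpr fun ψ' hψ' => ?_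
      rw [← mul_smul, he.2.2.1 ψ' ψ.1 (fun h => ψ.2 (h ▸ hψ')), zero_smul]
    · have hA : Φ c = ∑ ψ : A, e ψ.1 • w := by
        funext i
        rw [hΦ, Finset.sum_apply]
        refine Finset.sum_congr rfl fun ψ _ => ?_
        rw [Pi.smul_apply, smul_eq_mul, hc i ψ]
      rw [hA, Fintype.sum_subtype_add_sum_subtype (fun ψ => r ψ = n) (fun ψ => e ψ • w)]
      exact decomp w
  -- `Ψ` is onto
  have hΨsurj : Function.Surjective Ψ := by
    intro p
    obtain ⟨w, rfl⟩ := hq p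
    obtain ⟨c, z, hz, hw⟩ := split w
    refine ⟨c, ?_⟩
    rw [hΨ, hw, map_add, hE'ker z hz, add_zero]
  -- ranks: `rk P = Σ r_φ = n·|A| = rk (Fin n → A → R)`
  have hsum : ∑ φ, r φ = n * Fintype.card A := by
    rw [← Fintype.sum_subtype_add_sum_subtype (fun ψ => r ψ = n) r]
    have h1 : ∑ ψ : A, r ψ = ∑ _ψ : A, n := Finset.sum_congr rfl fun ψ _ => ψ.2
    have h2 : ∑ ψ : {ψ : ι // ¬ r ψ = n}, r ψ = 0 := Finset.sum_eq_zero fun ψ _ => hZ ψ.1 ψ.2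
    rw [h1, h2, add_zero, Finset.sum_const, Finset.card_univ, smul_eq_mul, mul_comm]
  have hrkP : Module.finrank R P = n * Fintype.card A := by
    rw [← LinearMap.charpoly_natDegree (act P ((1 : R) ⊗ₜ[OK] π)), hK π,
      Polynomial.natDegree_prod_of_monic _ _ fun φ _ => (monic_X_sub_C _).pow _]
    simp only [(monic_X_sub_C _).natDegree_pow, natDegree_X_sub_C, mul_one]
    exact hsum
  have hrkF : Module.finrank R (Fin n → A → R) = n * Fintype.card A := by
    rw [Module.finrank_pi_fintype R, Finset.sum_const, Finset.card_univ, Fintype.card_fin, smul_eq_mul,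
      Module.finrank_fintype_fun_eq_card]
  -- a surjection between free modules of the same rank is injective
  have hΨinj : Function.Injective Ψ := by
    let Θ : P ≃ₗ[R] (Fin n → A → R) := LinearEquiv.ofFinrankEq P (Fin n → A → R) (hrkP.trans hrkF.symm)
    have hsurj : Function.Surjective (Θ.toLinearMap ∘ₗ Ψ) := Θ.surjective.comp hΨsurj
    have hinj := OrzechProperty.injective_of_surjective_endomorphism _ hsurj
    exact fun c d hcd => hinj (by simp only [LinearMap.coe_comp, Function.comp_apply, hcd])
  -- conclusion: a kernel vector has no `A`-part
  obtain ⟨c, z, hz, hvz⟩ := split v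
  have hc : Ψ c = 0 := by
    rw [hΨ]
    have h := hv
    rw [hvz, map_add, hE'ker z hz, add_zero] at h
    exact h
  have hc0 : c = 0 := hΨinj (by rw [hc, map_zero])
  rw [hvz, hc0, map_zero, zero_add]
  exact hz

end Literature.AlgebraicGeometry.ShimuraVarieties.RapoportSmithlingZhang2020.AppBLocalModelsBanalSignature
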